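import Summits.QuantumFields.BalabanUV.T4Continuum.Support.MinimalActionLevels
import HarnessLib

/-!
# T⁴ programme, node NE3 (η-rate of the minimisers) — THE ACTION SANDWICH, part 2: admissible sets, minimal
# level actions, the TWO-COMPETITOR SANDWICH, and the periodic value wall β′-per plugged in BY NAME

Sixteenth generation of the NE3 prover lineage P1 of the cell `pub-balaban` (unit `b2b-balaban-t4-ne3-p1`, OWNER of
`BINDER-OWNERS.md` row NE3), file 2 of the «action sandwich» series; part 1 = `MinimalActionLevels` (level actions,
the composition law `avgIter_rescale_bavg`, the deficit identity `levelAction_rescale_bavg_sub`, class transport).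

THE POINT (all [folklore] order bookkeeping over an ABSTRACT family of admissibility classes).  Fix a block size `L`,
a unit-torus size `N`, a family `𝒞 : ℕ → Set (configurations)` («the space (6) of B11 at spacing `η = L^{−k}`» in the
dictionary — here ANY family of sets) and a datum `V`.  Run `k` minimises the level-`k` action
`MinimalActionLevels.levelAction` over `admissible 𝒞 L k V = {U ∈ 𝒞 k : avgIter L U k = V}` (the `k`-fold average
(43) prescribed); `minAct` is the infimum, `IsMinimiser` a minimiser.  Then:
 * `rescale_bavg_mem_admissible`: the (rescaled) one-step average of an admissible configuration of run `k+1` is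
   admissible for run `k` as soon as it lies in the class `𝒞 k` (composition law (43));
 * `mem_admissible_succ`: a configuration of class `𝒞 (k+1)` whose one-step average is admissible for run `k` is
   admissible for run `k+1`;
 * **`minAct_le_succ_add`** (UPPER HALF): `A_k(V) ≤ A_{k+1}(V) + (L^{4−d})^{k+1}·𝓓(U_B)` for any minimiser `U_B` of
   run `k+1` whose average lies in `𝒞 k` — the averaged finer minimiser COMPETES in run `k`;
 * **`minAct_succ_le_sub`** (LOWER HALF): `A_{k+1}(V) ≤ A_k(V) − (L^{4−d})^{k+1}·𝓓(Ũ)` for any `Ũ ∈ 𝒞 (k+1)` whose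
   one-step average IS a minimiser `U_A` of run `k` — a refinement of the coarser minimiser COMPETES in run `k+1`;
 * **`abs_minAct_sub_minAct_le`** (THE SANDWICH): `|A_k(V) − A_{k+1}(V)| ≤ (L^{4−d})^{k+1}·max(|𝓓(U_B)|, |𝓓(Ũ)|)`;
 * **`abs_minAct_sub_minAct_le_wall`**: with row NE3-R2's PROVED periodic value wall β′-per
   (`T4AveragingDeficitNonAbelian.abs_deficit_torus_le`, constant `wallConstNA d L` BY NAME) for the two competitors
   (`U(N)`-valued, `(N·L^{k+1})`-periodic, `SmallField · a` with `512(d+1)(d+4)L²a ≤ 1`, `‖∇F‖²_{ℓ²} ≤ G`):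
   `|A_k(V) − A_{k+1}(V)| ≤ (L^{4−d})^{k+1}·wallConstNA(d,L)·(G + a³(N L^k)^d)`.
NO response bound, NO convexity (ML), NO Fermat (R0), NO lift (γ), NO derivative wall (β), NO propagator reading
((W1)/(W2) of the print route) enters: for the ACTION reading of NE3 the two lineages' machinery is not needed.  What
IS needed is typed in part 3 (`MinimalActionRate`): existence of minimisers with printed-TYPE regularity at every level
(B11 Thm 1 (8)–(10)) and of a regular one-step refinement (Thm 1 for one step), plus `avg(U_B) ∈ 𝒞 k` (B7 Prop. 1 =
tree `prop1_explicit` for the small-field class).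

HONEST FRAMING.  Finite-T⁴ ultraviolet bookkeeping about MINIMISERS (rung (B)+1 of the cell's ladder); no estimate is
proved here (the wall is IMPORTED, proved by row NE3-R2, p199890 ff.); no conditional of the cell (`BetaPertH`, (B),
(B^μ)) is used or hidden; nothing bears on infinite volume, a mass gap, or the Clay problem; NE3 is NOT proved by this
file (its hypotheses name two competitors per level; whether Bałaban's minimisers supply them is B11 Thm 1, asserted
nowhere here).  ABSOLUTE RULE of the cell kept: no printed sentence is a hypothesis; inputs are kernel-proved tree
modules only; no `sorry`, no axioms beyond Mathlib's.  PLACEMENT (human rule 2026-08-19): cell work under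
`Summits/QuantumFields/BalabanUV/`; imports `Support.MinimalActionLevels` only; moves nothing.  Records:
`t4/T4-EST-U1b-OSC.md` v1.34, `t4/T4-EST-NE3-P1.md` v2.33 of the cell `pub-balaban`.
-/

set_option autoImplicit false

open scoped BigOperators Matrix Matrix.Norms.L2Operator
open NormedSpace Finset

namespace Summit.QuantumFields.BalabanUV.T4Continuum.MinimalActionSandwich

open Literature.MathematicalPhysics.QuantumFieldTheory.Balaban1983to89
open B7Prop1Explicit B7Prop2Explicit MatrixLog UnitaryModel
open T4AveragingDeficitWall hiding Site Plane Plaq Bond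
open T4AveragingDeficitWallBoundary (IsPeriodicCfg periodBox blockSites_periodBox mem_periodBox card_periodBox)
open T4AveragingDeficitNonAbelian (wallConstNA wallConstNA_nonneg abs_deficit_torus_le)
open MinimalActionLevels

noncomputable section

variable {d : ℕ} {n : Type*} [Fintype n] [DecidableEq n]

local notation "𝕄" => Matrix n n ℂ
local notation "Site" => B7Prop1Explicit.Site

/-! ## §1 Admissible sets, the minimal level action, minimisers -/

/-- **THE ADMISSIBLE SET OF RUN `k` WITH DATUM `V`**: configurations of the class `𝒞 k` whose `k`-fold average (43) is
`V` (dictionary: B11 (3) «Ū^j = V on Λ_j» in the everywhere-small-field case, `𝒞 k` = the space (6) at `η = L^{−k}`).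
[cite: Balaban1985Variational, (3) p.278, (6) p.278] -/
def admissible (𝒞 : ℕ → Set (Site d → Fin d → 𝕄ˣ)) (L k : ℕ) (V : Site d → Fin d → 𝕄ˣ) :
    Set (Site d → Fin d → 𝕄ˣ) :=
  {U | U ∈ 𝒞 k ∧ avgIter L U k = V}

variable (d) in
/-- **THE MINIMAL LEVEL-`k` ACTION** with datum `V`: `A_k(V) = inf {A^{(k)}(U) : U ∈ admissible 𝒞 L k V}` (an honest
real infimum; `0` on an empty or unbounded-below image by Mathlib's convention — the theorems below always carry a
minimiser). [cite: Balaban1985Variational, (5)–(6) p.278] -/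
def minAct (𝒞 : ℕ → Set (Site d → Fin d → 𝕄ˣ)) (L N k : ℕ) (V : Site d → Fin d → 𝕄ˣ) : ℝ :=
  sInf (levelAction d L N k '' admissible 𝒞 L k V)

variable (d) in
/-- **A MINIMISER OF RUN `k`**: an admissible configuration whose level-`k` action is least among the admissible ones
(dictionary: B11 Thm 1's minimal configuration `U_k(V)`, [Balaban1985Variational] Thm 1 p. 279; EXISTENCE is Thm 1
and is asserted nowhere here — a SHAPE of ours, not a printed statement). [folklore] -/
@[folklore]
structure IsMinimiser (𝒞 : ℕ → Set (Site d → Fin d → 𝕄ˣ)) (L N k : ℕ) (V U : Site d → Fin d → 𝕄ˣ) : Prop where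
  /-- the minimiser is admissible -/
  mem : U ∈ admissible 𝒞 L k V
  /-- and its action is least -/
  le : ∀ U' ∈ admissible 𝒞 L k V, levelAction d L N k U ≤ levelAction d L N k U'

/-- A minimiser realises the infimum: `A_k(V) = A^{(k)}(U)`. [folklore] -/
theorem IsMinimiser.minAct_eq {𝒞 : ℕ → Set (Site d → Fin d → 𝕄ˣ)} {L N k : ℕ} {V U : Site d → Fin d → 𝕄ˣ}
    (h : IsMinimiser d 𝒞 L N k V U) : minAct d 𝒞 L N k V = levelAction d L N k U := by
  refine IsLeast.csInf_eq ⟨Set.mem_image_of_mem _ h.mem, ?_⟩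
  rintro _ ⟨U', hU', rfl⟩
  exact h.le U' hU'

/-- Hence the infimum is below the action of every admissible configuration (once a minimiser exists). [folklore] -/
theorem IsMinimiser.minAct_le {𝒞 : ℕ → Set (Site d → Fin d → 𝕄ˣ)} {L N k : ℕ} {V U : Site d → Fin d → 𝕄ˣ}
    (h : IsMinimiser d 𝒞 L N k V U) {U' : Site d → Fin d → 𝕄ˣ} (hU' : U' ∈ admissible 𝒞 L k V) :
    minAct d 𝒞 L N k V ≤ levelAction d L N k U' := by
  rw [h.minAct_eq]; exact h.le U' hU'

/-! ## §2 Admissibility transfer across one averaging step -/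

/-- **DOWN**: the rescaled one-step average of an admissible configuration of run `k+1` is admissible for run `k` as
soon as it lies in the class `𝒞 k` — its `k`-fold average is the `(k+1)`-fold average of the original, i.e. the datum
(`MinimalActionLevels.avgIter_rescale_bavg`, (43)). [cite: Balaban1985Averaging, (43) p.24] -/
theorem rescale_bavg_mem_admissible {𝒞 : ℕ → Set (Site d → Fin d → 𝕄ˣ)} {L k : ℕ} {V U : Site d → Fin d → 𝕄ˣ}
    (hU : U ∈ admissible 𝒞 L (k + 1) V) (h𝒞 : rescale L (bavg L U) ∈ 𝒞 k) :
    rescale L (bavg L U) ∈ admissible 𝒞 L k V :=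
  ⟨h𝒞, by rw [avgIter_rescale_bavg]; exact hU.2⟩

/-- **UP**: a configuration of class `𝒞 (k+1)` whose rescaled one-step average is admissible for run `k` is admissible
for run `k+1`. [cite: Balaban1985Averaging, (43) p.24] -/
theorem mem_admissible_succ {𝒞 : ℕ → Set (Site d → Fin d → 𝕄ˣ)} {L k : ℕ} {V Ut Ua : Site d → Fin d → 𝕄ˣ}
    (hUt : Ut ∈ 𝒞 (k + 1)) (havg : rescale L (bavg L Ut) = Ua) (hUa : Ua ∈ admissible 𝒞 L k V) :
    Ut ∈ admissible 𝒞 L (k + 1) V :=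
  ⟨hUt, by rw [← avgIter_rescale_bavg, havg]; exact hUa.2⟩

/-! ## §3 The two halves and the sandwich -/

/-- **UPPER HALF OF THE SANDWICH** — the averaged finer minimiser competes in the coarser run:
`A_k(V) ≤ A_{k+1}(V) + (L^{4−d})^{k+1} · 𝓓_{W([0,NL^k)^d)}(U_B)` for every minimiser `U_B` of run `k+1` whose rescaled
one-step average lies in `𝒞 k` (and any minimiser of run `k`, which fixes the value `A_k(V)`). [folklore] -/
theorem minAct_le_succ_add {𝒞 : ℕ → Set (Site d → Fin d → 𝕄ˣ)} {L N k : ℕ} (hL : 1 ≤ L)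
    {V UA UB : Site d → Fin d → 𝕄ˣ} (hA : IsMinimiser d 𝒞 L N k V UA) (hB : IsMinimiser d 𝒞 L N (k + 1) V UB)
    (hW : rescale L (bavg L UB) ∈ 𝒞 k) :
    minAct d 𝒞 L N k V
      ≤ minAct d 𝒞 L N (k + 1) V
          + ((stepWt d L)⁻¹) ^ (k + 1) * deficit L UB (blockWindow L (periodBox (N * L ^ k))) := by
  have h1 : minAct d 𝒞 L N k V ≤ levelAction d L N k (rescale L (bavg L UB)) :=
    hA.minAct_le (rescale_bavg_mem_admissible hB.mem hW)
  rw [hB.minAct_eq, levelAction_succ_eq L N k hL UB]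
  linarith

/-- **LOWER HALF OF THE SANDWICH** — a refinement of the coarser minimiser competes in the finer run:
`A_{k+1}(V) ≤ A_k(V) − (L^{4−d})^{k+1} · 𝓓_{W([0,NL^k)^d)}(Ũ)` for every `Ũ ∈ 𝒞 (k+1)` whose rescaled one-step average
is a minimiser `U_A` of run `k`. [folklore] -/
theorem minAct_succ_le_sub {𝒞 : ℕ → Set (Site d → Fin d → 𝕄ˣ)} {L N k : ℕ} (hL : 1 ≤ L)
    {V UA UB Ut : Site d → Fin d → 𝕄ˣ} (hA : IsMinimiser d 𝒞 L N k V UA) (hB : IsMinimiser d 𝒞 L N (k + 1) V UB)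
    (hUt : Ut ∈ 𝒞 (k + 1)) (havg : rescale L (bavg L Ut) = UA) :
    minAct d 𝒞 L N (k + 1) V
      ≤ minAct d 𝒞 L N k V
          - ((stepWt d L)⁻¹) ^ (k + 1) * deficit L Ut (blockWindow L (periodBox (N * L ^ k))) := by
  have h1 : minAct d 𝒞 L N (k + 1) V ≤ levelAction d L N (k + 1) Ut :=
    hB.minAct_le (mem_admissible_succ hUt havg hA.mem)
  rw [hA.minAct_eq, ← havg]
  rw [levelAction_succ_eq L N k hL Ut] at h1
  exact h1

/-- **THE SANDWICH**: `|A_k(V) − A_{k+1}(V)| ≤ (L^{4−d})^{k+1} · max(|𝓓(U_B)|, |𝓓(Ũ)|)` — the consecutive minimal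
actions differ by at most the printed weight times the larger of the two competitors' AVERAGING DEFICITS on the full
period window.  Inputs: a minimiser of each run, the class membership of the averaged finer minimiser, and a
class-`(k+1)` refinement of the coarser minimiser. [folklore] -/
theorem abs_minAct_sub_minAct_le {𝒞 : ℕ → Set (Site d → Fin d → 𝕄ˣ)} {L N k : ℕ} (hL : 1 ≤ L)
    {V UA UB Ut : Site d → Fin d → 𝕄ˣ} (hA : IsMinimiser d 𝒞 L N k V UA) (hB : IsMinimiser d 𝒞 L N (k + 1) V UB)
    (hW : rescale L (bavg L UB) ∈ 𝒞 k) (hUt : Ut ∈ 𝒞 (k + 1)) (havg : rescale L (bavg L Ut) = UA) :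
    |minAct d 𝒞 L N k V - minAct d 𝒞 L N (k + 1) V|
      ≤ ((stepWt d L)⁻¹) ^ (k + 1)
          * max |deficit L UB (blockWindow L (periodBox (N * L ^ k)))|
                |deficit L Ut (blockWindow L (periodBox (N * L ^ k)))| := by
  have hc : 0 ≤ ((stepWt d L)⁻¹) ^ (k + 1) := pow_nonneg (inv_nonneg.mpr (stepWt_pos (d := d) L hL).le) _
  have hup := minAct_le_succ_add hL hA hB hW
  have hlo := minAct_succ_le_sub hL hA hB hUt havg
  set c := ((stepWt d L)⁻¹) ^ (k + 1) with hcdef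
  set DB := deficit L UB (blockWindow L (periodBox (N * L ^ k))) with hDB
  set DT := deficit L Ut (blockWindow L (periodBox (N * L ^ k))) with hDT
  have hB' : c * DB ≤ c * max |DB| |DT| :=
    mul_le_mul_of_nonneg_left ((le_abs_self DB).trans (le_max_left _ _)) hc
  have hT' : -(c * DT) ≤ c * max |DB| |DT| := by
    have : -DT ≤ max |DB| |DT| := (neg_le_abs DT).trans (le_max_right _ _)
    nlinarith
  rw [abs_le]
  constructor <;> linarith

/-! ## §4 The periodic value wall β′-per plugged in BY NAME (row NE3-R2's exit) -/

/-- The deficit of one competitor of run `k+1`, bounded by the PROVED periodic value wall β′-per of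
`T4AveragingDeficitNonAbelian` (constant `wallConstNA d L` by name): for a `U(N)`-valued `(N·L^{k+1})`-periodic `U` in
`SmallField U a`, `512(d+1)(d+4)L²a ≤ 1`, `N, L ≥ 1`:
`|𝓓_{W([0,NL^k)^d)}(U)| ≤ wallConstNA(d,L)·(‖∇_U F‖²_{ℓ²([0,NL^{k+1})^d)} + a³·(N L^k)^d)`. [folklore] -/
theorem abs_deficit_level_le [Nonempty n] {L N k : ℕ} (hL : 1 ≤ L) (hN : 1 ≤ N) {U : Site d → Fin d → 𝕄ˣ}
    (hU : IsUnitaryCfg U) (hP : IsPeriodicCfg U ((N * L ^ (k + 1) : ℕ) : ℤ)) {a : ℝ} (ha : 0 ≤ a)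
    (hsmall : 512 * (d + 1) * (d + 4) * (L : ℝ) ^ 2 * a ≤ 1) (hUa : SmallField U a) :
    |deficit L U (blockWindow L (periodBox (N * L ^ k)))|
      ≤ wallConstNA d L * (gradFluxSq U (periodBox (N * L ^ (k + 1))) + a ^ 3 * ((N * L ^ k : ℕ) : ℝ) ^ d) := by
  have hM : 1 ≤ N * L ^ k := Nat.one_le_iff_ne_zero.mpr (Nat.mul_ne_zero (by omega) (pow_ne_zero _ (by omega)))
  have hP' : IsPeriodicCfg U ((L : ℤ) * (N * L ^ k : ℕ)) := by
    have : ((N * L ^ (k + 1) : ℕ) : ℤ) = (L : ℤ) * (N * L ^ k : ℕ) := by push_cast; ring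
    rw [← this]; exact hP
  have h := abs_deficit_torus_le L (N * L ^ k) hL hM hU hP' ha hsmall hUa
  rwa [blockSites_periodBox L (N * L ^ k) hL, show L * (N * L ^ k) = N * L ^ (k + 1) by ring] at h

/-- **THE SANDWICH WITH THE WALL**: if both competitors of run `k+1` (the minimiser `U_B` and the refinement `Ũ` of the
run-`k` minimiser) are `U(N)`-valued, `(N·L^{k+1})`-periodic, in `SmallField · a` with `512(d+1)(d+4)L²a ≤ 1`, and have
`‖∇F‖²_{ℓ²(period)} ≤ G`, then
`|A_k(V) − A_{k+1}(V)| ≤ (L^{4−d})^{k+1} · wallConstNA(d,L) · (G + a³ (N L^k)^d)`.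
Everything about RESPONSE ∕ CONVEXITY ∕ CRITICALITY ∕ LIFTS ∕ PROPAGATORS is absent; the wall is row NE3-R2's theorem.
[folklore] -/
theorem abs_minAct_sub_minAct_le_wall [Nonempty n] {𝒞 : ℕ → Set (Site d → Fin d → 𝕄ˣ)} {L N k : ℕ}
    (hL : 1 ≤ L) (hN : 1 ≤ N) {V UA UB Ut : Site d → Fin d → 𝕄ˣ}
    (hA : IsMinimiser d 𝒞 L N k V UA) (hB : IsMinimiser d 𝒞 L N (k + 1) V UB)
    (hW : rescale L (bavg L UB) ∈ 𝒞 k) (hUt : Ut ∈ 𝒞 (k + 1)) (havg : rescale L (bavg L Ut) = UA)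
    (hBu : IsUnitaryCfg UB) (hBp : IsPeriodicCfg UB ((N * L ^ (k + 1) : ℕ) : ℤ))
    (hTu : IsUnitaryCfg Ut) (hTp : IsPeriodicCfg Ut ((N * L ^ (k + 1) : ℕ) : ℤ))
    {a G : ℝ} (ha : 0 ≤ a) (hsmall : 512 * (d + 1) * (d + 4) * (L : ℝ) ^ 2 * a ≤ 1)
    (hBa : SmallField UB a) (hTa : SmallField Ut a)
    (hBG : gradFluxSq UB (periodBox (N * L ^ (k + 1))) ≤ G) (hTG : gradFluxSq Ut (periodBox (N * L ^ (k + 1))) ≤ G) :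
    |minAct d 𝒞 L N k V - minAct d 𝒞 L N (k + 1) V|
      ≤ ((stepWt d L)⁻¹) ^ (k + 1) * (wallConstNA d L * (G + a ^ 3 * ((N * L ^ k : ℕ) : ℝ) ^ d)) := by
  have hc : 0 ≤ ((stepWt d L)⁻¹) ^ (k + 1) := pow_nonneg (inv_nonneg.mpr (stepWt_pos (d := d) L hL).le) _
  have hWc := wallConstNA_nonneg (d := d) L
  refine (abs_minAct_sub_minAct_le hL hA hB hW hUt havg).trans (mul_le_mul_of_nonneg_left ?_ hc)
  refine max_le ?_ ?_
  · refine (abs_deficit_level_le hL hN hBu hBp ha hsmall hBa).trans ?_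
    exact mul_le_mul_of_nonneg_left (by linarith) hWc
  · refine (abs_deficit_level_le hL hN hTu hTp ha hsmall hTa).trans ?_
    exact mul_le_mul_of_nonneg_left (by linarith) hWc

end

end Summit.QuantumFields.BalabanUV.T4Continuum.MinimalActionSandwich
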